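import Summits.QuantumFields.QCD.Theses.WilsonMobilityGap
import Summits.QuantumFields.QCD.Theses.PauliWegnerSea
import Summits.QuantumFields.QCD.Theorems.PauliWegnerSeaTiltedFlatness

/-!
# `MobilityGap` (stmt-QuantumFields-9150) is a corollary of the sibling route's cruxes

Route `PauliWegnerSea` splits the Wilson mobility gap into a PRODUCER and a CONSUMER:
`OneScaleTrajectory` (stmt-QuantumFields-11513) is `WilsonMobilityGap.MobilityGap` with clause (ii)
replaced by the one-scale fractional-moment input, and `FMClosureUnquenched`
(stmt-QuantumFields-11512) is `FibreCofactorDomination → TiltedFlatness → (one-scale input ⇒ (ii))`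
for every regularisation and every positive mass tuple. `TiltedFlatness` (stmt-QuantumFields-14070)
is proved in the tree (`CircleTransport.TiltedFlatness_proof`). Hence, by propositional bookkeeping
(all clause texts are generated from one template and agree syntactically):

`FibreCofactorDomination → FMClosureUnquenched → OneScaleTrajectory → MobilityGap`.

This records that crux 9150 is implied by cruxes 11510 ∧ 11512 ∧ 11513 of the sibling route; it is
a CONDITIONAL result (the three hypotheses are open items; 11512 is over-stated as filed, see
`Cruxes/FMClosureUnquenched/FINAL-c1.md`, which only makes the implication weaker to use, not wrong).
-/

namespace Summit.QuantumFields.QCD.Theorems.WilsonMobilityGap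

open Summit.QuantumFields.QCD.Theses

/-- **Sibling reduction.** The three cruxes `FibreCofactorDomination` (K1), `FMClosureUnquenched`
(K2) and `OneScaleTrajectory` (T) of route `PauliWegnerSea` imply `WilsonMobilityGap.MobilityGap`:
T supplies the regularisation with both scalings and, for every `m > 0`, clauses (i), (iii), (iv)
and the one-scale input; K2 (fed K1 and the PROVED K3 `TiltedFlatness`) turns the input into
clause (ii). Pure logic; no analysis. -/
theorem mobilityGap_of_pauliWegnerSea_cruxes
    (hK1 : PauliWegnerSea.FibreCofactorDomination)
    (hK2 : PauliWegnerSea.FMClosureUnquenched)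
    (hT : PauliWegnerSea.OneScaleTrajectory) :
    WilsonMobilityGap.MobilityGap := by
  intro Nf hNf
  obtain ⟨reg, hMS, hAS, h⟩ := hT Nf hNf
  refine ⟨reg, hMS, hAS, fun m hm => ?_⟩
  obtain ⟨h1, hIn, h3, h4⟩ := h m hm
  exact ⟨h1, hK2 hK1 CircleTransport.TiltedFlatness_proof Nf reg m hm hIn, h3, h4⟩

end Summit.QuantumFields.QCD.Theorems.WilsonMobilityGap
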